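import Summits.QuantumAdvantage.QuantumAdvantage.Theorems.NearExactIsExact.Negative.ProductTestDegree
import Summits.QuantumAdvantage.QuantumAdvantage.Theorems.CubicForrelationNearExactIsExactRothausB
import Summits.QuantumAdvantage.QuantumAdvantage.Theorems.CubicForrelationNearExactIsExactRankTwoCeilingA

/-!
# `NearExactIsExact` (stmt-QuantumAdvantage-14043) — the bijective Maiorana–McFarland habitat at `s = 8, 9, 10`

BQ-s habitat of the crux (b2b cell, DISPROOF §10.4–§10.5, §14, §43): `π, τ` mutually inverse coordinatewise
QUADRATIC maps of `𝔽₂ˢ`, `c₁, c₂` cubic, residual word `r = c₁ ⊕ c₂∘π`; the bijective Maiorana–McFarland cubic pair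
built on them at `n = 2s` has `Φ = 1 − 2·wt(r)/2ˢ` (`MmPairFixedPoints.forrelation_mmPair_of_leftInverse`), so
`Φ ∈ (15/16, 1)` iff `0 < wt(r) < 2^{s−5}` and `Φ = 31/32` iff `r` is the indicator of an `(s−6)`-flat
(a minimum-weight word of `RM(6,s)`). DISPROOF §10.4 settles `s ≤ 10` on paper; kernel-checked so far were
`s = 7` (`BqqSeven.bqq_seven`: `wt(r) ∈ {0} ∪ [8,∞)`, i.e. `Φ = 1 ∨ Φ ≤ 7/8` at `n = 14`) and the attained value
`15/16` at `s = 8` (`BqqEightFifteenSixteenths`). This file adds, from the all-`s` PRODUCT TEST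
(`ProductTest.productTest`) and Reed–Muller duality (`RMDual`, `ProductTestDegree.isDegLeFun_comp_param`):

* `bqq_eight` (**BQQ(8) window**, `s = 8`): `wt(r) ∈ {0} ∪ [8, ∞)` — the test `(d₁,d₂) = (2,0)` makes `r` orthogonal
  to `RM(2,8)`, so `deg r ≤ 5` by RM duality and `wt(r) ≥ 2^{8−5}` by the Reed–Muller minimum weight
  (`bb_rmWeight_holds`); `forrelation_bijectiveMm_sixteen`: every bijective biquadratic Maiorana–McFarland cubic
  pair at `n = 16` has `Φ = 1 ∨ Φ ≤ 15/16` — SHARP, `15/16` being attained in this very class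
  (`BqqEightFifteenSixteenths.forrelation_f16b_g16b`): MM-GAP holds with equality at `n = 16`.
* `bq_nine_flat` (`s = 9`) and `bq_ten_flat` (`s = 10`): the residual is never the indicator of a `3`-flat,
  resp. `4`-flat `U = e(𝔽₂^m)` (given, as in `ProductTestDegree`, by a parametrisation `e` with a coordinatewise
  affine retraction `ρ`; every flat has one) — i.e. NO bijective biquadratic MM pair at `n = 18, 20` has
  `Φ = 31/32` (question BQ-9, BQ-10 of DISPROOF §10.5). Proofs: at `s = 9` the test `(2,1)` forces every
  component of `π∘e` to be CONSTANT (`k = 0`), contradicting injectivity; at `s = 10` the tests `(2,1)` and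
  `(2,2)` force the components of `π∘e` AND their pairwise products to be affine (`k = 1`); restricted to a
  2-flat these are even-weight functions on 4 points, and an injective map all of whose components and pairwise
  component-products have even weight on `𝔽₂²` does not exist (`even_pair_kernel`, elementary counting).

HONEST FRAMING: THEOREMS about three finite slices of ONE habitat of the crux (kernel-checked; they make the
paper statement "MM-GAP(∀n) proved for n ≤ 20" of DISPROOF §10.4 formal in its 31/32 part and complete at
`n = 16`), NOT summit progress: no violation of `NearExactIsExact`, no new per-`n` value.
Sources (orientation only): F. J. MacWilliams, N. J. A. Sloane, The Theory of Error-Correcting Codes (1977),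
Ch. 13 (Reed–Muller weights and duals); everything used is proved in the tree; standard axioms.
-/

set_option linter.dupNamespace false -- D-0017: single-problem summit ⇒ `QuantumAdvantage.QuantumAdvantage` by design

namespace Summit.QuantumAdvantage.QuantumAdvantage.Theorems.NearExactIsExact.Negative.BqqEightNineTen

open Finset
open Literature.Computability.QuantumComplexity
open Summit.QuantumAdvantage.QuantumAdvantage.Theorems.CubicForrelation.NearExactIsExact
  (fc_isDegLeFun_comp te_isDegLeFun_band bb_rmWeight_holds fc_sum_signOf_eq_card ar_const_of_deg_zero)
open Summit.QuantumAdvantage.QuantumAdvantage.Theorems.NearExactIsExact.Negative.MmPairFixedPoints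
  (forrelation_mmPair_of_leftInverse)
open Summit.QuantumAdvantage.QuantumAdvantage.Theorems.NearExactIsExact.Negative.ProductTest
  (productTest even_card_of_deg_lt)
open Summit.QuantumAdvantage.QuantumAdvantage.Theorems.NearExactIsExact.Negative.RMDual
  (isDegLeFun_of_orthogonal)
open Summit.QuantumAdvantage.QuantumAdvantage.Theorems.NearExactIsExact.Negative.ProductTestDegree
  (isDegLeFun_comp_param)

/-! ### Small tools -/

/-- `¬(a ⊕ b) ⇒ a = b`. [folklore] -/
theorem eq_of_not_xor {a b : Bool} (h : ¬ (a ^^ b) = true) : a = b := by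
  cases a <;> cases b <;> simp_all

/-- **The `𝔽₂²` kernel.** There is no point-separating family `b i` of Boolean functions on `𝔽₂²` such that
every `b i` and every product `b i ∧ b j` has even weight: a separating family has a non-constant member
`b i`, whose support is then a pair `{x, y}`; every `b j` takes an even number of `true`s on that pair, hence
agrees at `x` and `y` — so `x, y` are not separated. [folklore] -/
theorem even_pair_kernel {s : ℕ} (b : Fin s → (Fin 2 → Bool) → Bool)
    (hE1 : ∀ i, Even #(univ.filter fun v : Fin 2 → Bool => b i v = true))
    (hE2 : ∀ i j, Even #(univ.filter fun v : Fin 2 → Bool => (b i v && b j v) = true))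
    (hsep : ∀ v w : Fin 2 → Bool, (∀ i, b i v = b i w) → v = w) : False := by
  classical
  let v₀ : Fin 2 → Bool := fun _ => false
  let v₁ : Fin 2 → Bool := fun _ => true
  have hne : v₀ ≠ v₁ := fun h => Bool.false_ne_true (congrFun h 0)
  -- a non-constant member
  obtain ⟨i, hi⟩ : ∃ i, b i v₀ ≠ b i v₁ := by
    by_contra h
    push Not at h
    exact hne (hsep v₀ v₁ h)
  set S := univ.filter fun v : Fin 2 → Bool => b i v = true with hS
  have hcardU : #(univ : Finset (Fin 2 → Bool)) = 4 := by simp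
  -- `S` is neither empty nor everything, and has even size: it is a pair
  have hmem : ∀ v, v ∈ S ↔ b i v = true := fun v => by simp [hS]
  obtain ⟨vin, vout, hvin, hvout⟩ : ∃ vin vout, b i vin = true ∧ b i vout = false := by
    cases h0 : b i v₀ <;> cases h1 : b i v₁
    · exact absurd (h0.trans h1.symm) hi
    · exact ⟨v₁, v₀, h1, h0⟩
    · exact ⟨v₀, v₁, h0, h1⟩
    · exact absurd (h0.trans h1.symm) hi
  have hpos : 0 < #S := card_pos.mpr ⟨vin, (hmem vin).mpr hvin⟩
  have hlt : #S < 4 := by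
    rw [← hcardU]
    refine card_lt_card (Finset.ssubset_iff_subset_ne.mpr ⟨subset_univ _, fun h => ?_⟩)
    have : vout ∈ S := h ▸ mem_univ vout
    rw [hmem] at this
    rw [this] at hvout
    exact Bool.noConfusion hvout
  have h2 : #S = 2 := by
    obtain ⟨t, ht⟩ := hE1 i
    rw [← hS] at ht
    omega
  obtain ⟨x, y, hxy, hSxy⟩ := card_eq_two.mp h2
  -- every `b j` agrees at `x` and `y`
  have hagree : ∀ j, b j x = b j y := by
    intro j
    have hT : (univ.filter fun v : Fin 2 → Bool => (b i v && b j v) = true) =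
        S.filter fun v => b j v = true := by
      ext v
      simp [hS, Bool.and_eq_true]
    have hev := hE2 i j
    rw [hT, hSxy, filter_insert, filter_singleton] at hev
    by_contra hxy'
    cases hx : b j x <;> cases hy : b j y
    · exact hxy' (hx.trans hy.symm)
    · simp [hx, hy] at hev
    · rw [if_pos hx, if_neg (by rw [hy]; exact Bool.false_ne_true)] at hev
      simp at hev
    · exact hxy' (hx.trans hy.symm)
  -- but `x ∈ S`, `y ∈ S` are separated only through `b`: contradiction
  exact hxy (hsep x y hagree)

/-- Lift of the kernel to `𝔽₂^m`, `m ≥ 2`: no injective map `u ↦ (P i u)_i` on `𝔽₂^m` has all components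
`P i` AND all pairwise products `P i ∧ P j` of degree `≤ 1` (restrict to the 2-flat `u₂ = … = 0`, where
degree `≤ 1 < 2` means even weight, and apply `even_pair_kernel`). [folklore] -/
theorem affine_pair_kernel {m s : ℕ} (hm : 2 ≤ m) (P : Fin s → (Fin m → Bool) → Bool)
    (A1 : ∀ i, IsDegLeFun 1 (P i)) (A2 : ∀ i j, IsDegLeFun 1 (fun u => P i u && P j u))
    (hinj : ∀ u v : Fin m → Bool, (∀ i, P i u = P i v) → u = v) : False := by
  classical
  -- the coordinate embedding of `𝔽₂²`
  let ι : (Fin 2 → Bool) → (Fin m → Bool) := fun v k => if h : (k : ℕ) < 2 then v ⟨k, h⟩ else false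
  have hι : ∀ k, IsDegLeFun 1 (fun v => ι v k) := by
    intro k
    by_cases h : (k : ℕ) < 2
    · have e : (fun v : Fin 2 → Bool => ι v k) = fun v => v ⟨k, h⟩ := funext fun v => dif_pos h
      rw [e]
      exact isDegLeFun_apply _ le_rfl
    · have e : (fun v : Fin 2 → Bool => ι v k) = fun _ => false := funext fun v => dif_neg h
      rw [e]
      exact isDegLeFun_const 1 false
  have hιapp : ∀ (v : Fin 2 → Bool) (t : Fin 2), ι v ⟨t, lt_of_lt_of_le t.isLt hm⟩ = v t := fun v t => by
    show (if h : ((⟨t, lt_of_lt_of_le t.isLt hm⟩ : Fin m) : ℕ) < 2 then v ⟨_, h⟩ else false) = v t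
    rw [dif_pos t.isLt]
  let b : Fin s → (Fin 2 → Bool) → Bool := fun i v => P i (ι v)
  have hb1 : ∀ i, IsDegLeFun 1 (b i) := fun i => fc_isDegLeFun_comp (A1 i) ι hι (by norm_num)
  have hb2 : ∀ i j, IsDegLeFun 1 (fun v => b i v && b j v) := fun i j =>
    fc_isDegLeFun_comp (A2 i j) ι hι (by norm_num)
  refine even_pair_kernel b (fun i => even_card_of_deg_lt (hb1 i) (by norm_num))
    (fun i j => even_card_of_deg_lt (hb2 i j) (by norm_num)) fun v w hvw => ?_
  have hιvw : ι v = ι w := hinj (ι v) (ι w) hvw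
  funext t
  rw [← hιapp v t, ← hιapp w t, hιvw]

/-! ### `s = 8`: the window theorem BQQ(8) and MM-GAP at `n = 16` -/

/-- **THEOREM BQQ(8) (window form).** For mutually inverse maps `π, τ : 𝔽₂⁸ → 𝔽₂⁸` of algebraic degree `≤ 2`
(`τ ∘ π = id` suffices) and cubic `c₁, c₂`, the word `c₁ ⊕ c₂∘π` is `0` or has weight `≥ 8 = 2^{8−5}`: the
product test with `(d₁,d₂) = (2,0)` makes it orthogonal to `RM(2,8)`, hence of degree `≤ 5` (RM duality), and a
non-zero word of `RM(5,8)` has weight `≥ 2³`. Sharp: weight `8` occurs (`BqqEightFifteenSixteenths`). [folklore] -/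
theorem bqq_eight (π τ : (Fin 8 → Bool) → (Fin 8 → Bool))
    (hπ : ∀ i, IsDegLeFun 2 (fun y => π y i)) (hτ : ∀ i, IsDegLeFun 2 (fun x => τ x i))
    (hτπ : ∀ y, τ (π y) = y)
    (c₁ c₂ : (Fin 8 → Bool) → Bool) (h₁ : IsDegLeFun 3 c₁) (h₂ : IsDegLeFun 3 c₂) :
    (∀ y, c₁ y = c₂ (π y)) ∨ 8 ≤ #(univ.filter fun y => (c₁ y ^^ c₂ (π y)) = true) := by
  classical
  have hinj : Function.Injective π := fun a b hab => by rw [← hτπ a, ← hτπ b, hab]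
  have hπτ : ∀ x, π (τ x) = x := fun x => by
    obtain ⟨y, rfl⟩ := Finite.surjective_of_injective hinj x
    rw [hτπ]
  -- D-orthogonality, test `(2,0)`: the residual is orthogonal to every quadratic
  have horth : ∀ p : (Fin 8 → Bool) → Bool, IsDegLeFun 2 p →
      Even #(univ.filter fun y : Fin 8 → Bool => (p y && (c₁ y ^^ c₂ (π y))) = true) := by
    intro p hp
    have key := productTest (d₁ := 2) (d₂ := 0) π τ hπ hτ hτπ hπτ c₁ c₂ h₁ h₂ p (fun _ => true) hp
      (isDegLeFun_const 0 true) (by norm_num) (by norm_num)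
    have hset : (univ.filter fun y : Fin 8 → Bool => (p y && (c₁ y ^^ c₂ (π y))) = true) =
        univ.filter fun y : Fin 8 → Bool => ((c₁ y ^^ c₂ (π y)) && (p y && true)) = true :=
      filter_congr fun y _ => by rw [Bool.and_true, Bool.and_comm]
    rw [hset]
    exact key
  have hdeg : IsDegLeFun 5 (fun y : Fin 8 → Bool => c₁ y ^^ c₂ (π y)) :=
    isDegLeFun_of_orthogonal (d := 2) (k := 5) (by norm_num) horth
  by_cases hex : ∃ y, (c₁ y ^^ c₂ (π y)) = true
  · right
    have hw := bb_rmWeight_holds 8 5 (fun y => c₁ y ^^ c₂ (π y)) hdeg hex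
    have hw' : 256 ≤ 32 * #(univ.filter fun y : Fin 8 → Bool => (c₁ y ^^ c₂ (π y)) = true) := by
      simpa using hw
    omega
  · left
    intro y
    exact eq_of_not_xor fun h => hex ⟨y, h⟩

/-- **MM-GAP at `n = 16` (bijective biquadratic class), sharp.** If `g(y₁‖y₂)` has sign
`(−1)^{y₁·π(y₂)}(−1)^{h(y₂)}` and `f(x₁‖x₂)` has sign `(−1)^{x₂·τ(x₁)}(−1)^{r(x₁)}` with `π, τ : 𝔽₂⁸ → 𝔽₂⁸` of
degree `≤ 2`, `τ ∘ π = id`, `h, r` cubic, then `Φ(f,g) = 1` or `Φ(f,g) ≤ 15/16` (`Φ = 1 − 2·wt(h ⊕ r∘π)/2⁸`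
and `bqq_eight`). The bound is attained in this class (`BqqEightFifteenSixteenths.forrelation_f16b_g16b`),
so `sup {Φ < 1} = 15/16` exactly for bijective biquadratic Maiorana–McFarland pairs at `n = 16`. [folklore] -/
theorem forrelation_bijectiveMm_sixteen (f g : (Fin (8 + 8) → Bool) → Bool)
    (π τ : (Fin 8 → Bool) → (Fin 8 → Bool)) (h r : (Fin 8 → Bool) → Bool)
    (hg : ∀ y₁ y₂ : Fin 8 → Bool, signOf (g (Fin.append y₁ y₂)) = twist y₁ (π y₂) * signOf (h y₂))
    (hf : ∀ x₁ x₂ : Fin 8 → Bool, signOf (f (Fin.append x₁ x₂)) = twist x₂ (τ x₁) * signOf (r x₁))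
    (hπ : ∀ i, IsDegLeFun 2 (fun y => π y i)) (hτ : ∀ i, IsDegLeFun 2 (fun x => τ x i))
    (hτπ : ∀ y, τ (π y) = y) (hh : IsDegLeFun 3 h) (hr : IsDegLeFun 3 r) :
    forrelation f g = 1 ∨ forrelation f g ≤ 15 / 16 := by
  classical
  rw [forrelation_mmPair_of_leftInverse f g π τ h r hg hf hτπ]
  have e : ∀ y : Fin 8 → Bool, signOf (h y) * signOf (r (π y)) = signOf (h y ^^ r (π y)) := fun y => by
    cases h y <;> cases r (π y) <;> simp [signOf]
  simp_rw [e]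
  rw [fc_sum_signOf_eq_card]
  have h256 : ((2 : ℝ) ^ 8)⁻¹ = 1 / 256 := by norm_num
  rw [h256]
  rcases bqq_eight π τ hπ hτ hτπ h r hh hr with h0 | h8
  · left
    have hempty : (univ.filter fun y : Fin 8 → Bool => (h y ^^ r (π y)) = true) = ∅ :=
      filter_eq_empty_iff.mpr fun y _ => by rw [h0 y]; simp
    rw [hempty, card_empty, Nat.cast_zero]
    norm_num
  · right
    have h8' : (8 : ℝ) ≤ (#(univ.filter fun y : Fin 8 → Bool => (h y ^^ r (π y)) = true) : ℝ) := by
      exact_mod_cast h8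
    linarith

/-! ### `s = 9, 10`: no codimension-6 flat residual (BQ-9, BQ-10) -/

/-- **BQ-9 is impossible.** At `s = 9` the residual `c₁ ⊕ c₂∘π` of a pair of mutually inverse coordinatewise
quadratic maps and two cubics is never the indicator of a `3`-flat `U = e(𝔽₂³)` (`ρ` a coordinatewise affine
retraction of `e`): the product test `(d₁,d₂) = (2,1)` and RM duality on `U` (`isDegLeFun_comp_param`, `k = 0`)
make every component of `π ∘ e` constant, while `π ∘ e` is injective. Hence no bijective biquadratic
Maiorana–McFarland cubic pair at `n = 18` has `Φ = 31/32`. [folklore] -/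
theorem bq_nine_flat (π τ : (Fin 9 → Bool) → (Fin 9 → Bool))
    (hπ : ∀ i, IsDegLeFun 2 (fun y => π y i)) (hτ : ∀ i, IsDegLeFun 2 (fun x => τ x i))
    (hτπ : ∀ y, τ (π y) = y) (hπτ : ∀ x, π (τ x) = x)
    (c₁ c₂ : (Fin 9 → Bool) → Bool) (h₁ : IsDegLeFun 3 c₁) (h₂ : IsDegLeFun 3 c₂)
    (e : (Fin 3 → Bool) → (Fin 9 → Bool)) (ρ : (Fin 9 → Bool) → (Fin 3 → Bool))
    (hρ : ∀ j, IsDegLeFun 1 (fun y => ρ y j)) (hρe : ∀ u, ρ (e u) = u)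
    (U : (Fin 9 → Bool) → Bool) (hU : ∀ y, U y = true ↔ ∃ u, e u = y) :
    ¬ ∀ y, (c₁ y ^^ c₂ (π y)) = U y := by
  intro hres
  have hconst : ∀ i, IsDegLeFun 0 (fun u => π (e u) i) := fun i =>
    isDegLeFun_comp_param (d₁ := 2) (d₂ := 1) (k := 0) (by norm_num) (by norm_num) (by norm_num)
      π τ hπ hτ hτπ hπτ c₁ c₂ h₁ h₂ e ρ hρ hρe U hU hres (fun y => y i) (isDegLeFun_apply i le_rfl)
  let u₀ : Fin 3 → Bool := fun _ => false
  let u₁ : Fin 3 → Bool := fun _ => true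
  have hpe : π (e u₀) = π (e u₁) := funext fun i => ar_const_of_deg_zero (hconst i) u₀ u₁
  have heu : e u₀ = e u₁ := by rw [← hτπ (e u₀), ← hτπ (e u₁), hpe]
  have hu : u₀ = u₁ := by rw [← hρe u₀, ← hρe u₁, heu]
  exact Bool.false_ne_true (congrFun hu 0)

/-- **BQ-10 is impossible.** At `s = 10` the residual `c₁ ⊕ c₂∘π` is never the indicator of a `4`-flat
`U = e(𝔽₂⁴)`: the product tests `(2,1)` and `(2,2)` with RM duality on `U` make the components of `π ∘ e` and
their pairwise products AFFINE (`k = 1`), and `affine_pair_kernel` says an injective map cannot have that.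
Hence no bijective biquadratic Maiorana–McFarland cubic pair at `n = 20` has `Φ = 31/32` (DISPROOF §10.4,
`s = 10`, `w = 16`, now kernel-checked). [folklore] -/
theorem bq_ten_flat (π τ : (Fin 10 → Bool) → (Fin 10 → Bool))
    (hπ : ∀ i, IsDegLeFun 2 (fun y => π y i)) (hτ : ∀ i, IsDegLeFun 2 (fun x => τ x i))
    (hτπ : ∀ y, τ (π y) = y) (hπτ : ∀ x, π (τ x) = x)
    (c₁ c₂ : (Fin 10 → Bool) → Bool) (h₁ : IsDegLeFun 3 c₁) (h₂ : IsDegLeFun 3 c₂)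
    (e : (Fin 4 → Bool) → (Fin 10 → Bool)) (ρ : (Fin 10 → Bool) → (Fin 4 → Bool))
    (hρ : ∀ j, IsDegLeFun 1 (fun y => ρ y j)) (hρe : ∀ u, ρ (e u) = u)
    (U : (Fin 10 → Bool) → Bool) (hU : ∀ y, U y = true ↔ ∃ u, e u = y) :
    ¬ ∀ y, (c₁ y ^^ c₂ (π y)) = U y := by
  intro hres
  have A1 : ∀ i, IsDegLeFun 1 (fun u => π (e u) i) := fun i =>
    isDegLeFun_comp_param (d₁ := 2) (d₂ := 1) (k := 1) (by norm_num) (by norm_num) (by norm_num)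
      π τ hπ hτ hτπ hπτ c₁ c₂ h₁ h₂ e ρ hρ hρe U hU hres (fun y => y i) (isDegLeFun_apply i le_rfl)
  have A2 : ∀ i j, IsDegLeFun 1 (fun u => π (e u) i && π (e u) j) := fun i j =>
    isDegLeFun_comp_param (d₁ := 2) (d₂ := 2) (k := 1) (by norm_num) (by norm_num) (by norm_num)
      π τ hπ hτ hτπ hπτ c₁ c₂ h₁ h₂ e ρ hρ hρe U hU hres (fun y => y i && y j)
      (te_isDegLeFun_band (a := 1) (b := 1) (isDegLeFun_apply i le_rfl) (isDegLeFun_apply j le_rfl))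
  refine affine_pair_kernel (by norm_num) (fun i u => π (e u) i) A1 A2 fun u v huv => ?_
  have hpe : π (e u) = π (e v) := funext huv
  have heu : e u = e v := by rw [← hτπ (e u), ← hτπ (e v), hpe]
  rw [← hρe u, ← hρe v, heu]

end Summit.QuantumAdvantage.QuantumAdvantage.Theorems.NearExactIsExact.Negative.BqqEightNineTen
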